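import Literature.Barriers.CriticalPhenomena.TimarCutExhaustion
import Literature.Barriers.CriticalPhenomena.TimarCutClasses
import Literature.Barriers.CriticalPhenomena.TimarForestTargets
import Literature.Barriers.CriticalPhenomena.TimarEncounterPoints
import Literature.Barriers.CriticalPhenomena.TimarRandomGraphs
import Literature.Barriers.CriticalPhenomena.TimarExhaustionBound
import Literature.Barriers.CriticalPhenomena.TimarLemma53Targets
import Literature.Barriers.CriticalPhenomena.TimarLemma53Existence
import HarnessLib

/-!
# Timár 2006, Thm. 5.5 by the cut route: the assembly — `Timar2006_finiteLevelUnion` PROVED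

Barrier catalogue `Literature/Barriers/CriticalPhenomena/`; the assembly of the cut route to
Timár's Thm. 5.5 (`Timar2006_finiteLevelUnion`, `TimarCriticalNonunimodular.lean`). Á. Timár,
*Percolation on nonunimodular transitive graphs*, Ann. Probab. 34 (2006) 2344–2364, §5, proof of
Thm. 5.5 (pp. 2358–2360). The printed proof refutes the existence of bad heavy clusters (heavy
clusters all of whose traces on finite unions of levels have finite components) by building, on
the encounter points of the bad heavy clusters lying in one class of the 1-partition, the forest
`F` (out-degree `≥ 3`), thinning it through bags to expected degree `> 2μ`, and comparing with
Lemma 5.1 along the exhaustion `R_i` of Prop. 5.4. The cut route replaces the last two steps by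
the deficit-versus-vanishing-cut contradiction of `TimarCutTransport.lean` /
`TimarCutExhaustion.lean`; everything else is the printed construction, taken from the tree:
the 1-partition (`TimarOnePartition.lean`), Prop. 5.4 (`TimarLevelExhaustion.lean`), badness and
the reduction to "almost surely infinitely many bad heavy clusters" (`TimarBadClusters.lean`),
encounter points (`TimarEncounterPoints.lean`), the forest (`TimarTargetForest.lean`,
`TimarForestTargets.lean`, `TimarRandomGraphs.lean`), the classes (`TimarCutClasses.lean`).

This file PROVES the theorem: first from the two statements of **Lemma 5.3** taken as
hypotheses (`Timar2006_finiteLevelUnion_of_lemma53`), then outright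
(`Timar2006_finiteLevelUnion_holds`) by the tree's proofs of these two statements
(`not_ae_forall_not_badEncounter`, `TimarLemma53Existence.lean`; `ae_exists_isEncounter_of_branch`,
`TimarLemma53Targets.lean`):

* (5.3 i) if almost surely there are infinitely many bad heavy clusters, then with positive
  probability some vertex is an encounter point of a bad heavy cluster ("The existence of
  encounter points follows from insertion tolerance");
* (5.3 ii) almost surely (percolation and 1-partition), for every encounter point `x` of a bad
  heavy cluster and every heavy branch `C` at `x`, `C` contains an encounter point of the class of
  `x` in the 1-partition ("`C ∩ L₀` contains some vertex that is an encounter point for `ω`").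

Contents: the sample space `CutSpace` (percolation, parameter of the 1-partition, labels, seeds
of the exhaustion) with its product law `cutMeasure` and the diagonal action `cutAct` of `Aut(G)`
by measure-preserving maps; the random data (points `cutPoints` = encounter points of bad heavy
clusters, pointing relation `Points` of `TimarTargetForest.lean` with the class relation of the
1-partition and the diagonal labels, classes `cutClass`); the verification of the hypotheses of
`measure_mem_eq_zero_of_cut_exhaustion` — invariance, measurability, the class package
(`TimarCutClasses.lean`), the forest package (acyclicity `targetGraph_isAcyclic`, degree window
from `TimarForestTargets.lean` and (5.3 ii)), and the exhaustion in probability (Fubini over the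
seeds: the section of the cut event above `(ω, θ, U)` is contained in "the levels of an open path
from `x` to `t` are split by `P_i`", `tendsto_measure_not_forall_levelExhaustionRel`); and the
conclusion `false_of_ae_infinite_bad_of_lemma53`, `Timar2006_finiteLevelUnion_of_lemma53`.

## References

* Á. Timár, Ann. Probab. 34 (2006) 2344–2364 (arXiv:math/0702875), §5: Lemma 5.3, Prop. 5.4,
  Thm. 5.5 and its proof. [Timar2006]
* R. Lyons, Y. Peres, *Probability on Trees and Networks*, CUP 2016, §8.2 ((8.10)). [LyonsPeres2016]
-/

noncomputable section

namespace Literature.Barriers.CriticalPhenomena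

open _root_.MeasureTheory _root_.Filter Literature.Probability.Percolation SimpleGraph
open scoped ENNReal Topology

variable {V : Type*}

attribute [local instance] isProbabilityMeasure_labelMeasure

/-! ### The points: encounter points of bad heavy clusters -/

/-- **The points of the forest**: encounter points of BAD HEAVY clusters ("Let `ω̄` be the
subgraph consisting of these `C`'s … Define a graph `Γ_W` on the set `W` of encounter points of
`ω̄` in `L₀`", here before restricting to a class). [cite: Timar2006, Thm. 5.5 (proof: the set W)] -/
def cutPoints (G : SimpleGraph V) [G.LocallyFinite] (o : V) (ω : BondConfig V) : Set V :=
  {x | IsHeavy G o (openCluster ω x) ∧ LevelBad G ω x ∧ IsEncounter G o ω x}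

section Points

variable {G : SimpleGraph V} [G.LocallyFinite]

/-- The points are transported by automorphisms. [cite: Timar2006, Thm. 5.5 (proof: "Note that ω̄ is invariant")] -/
theorem mem_cutPoints_relabel_iff (hconn : G.Connected) (γ : G ≃g G) (o : V) (ω : BondConfig V) (x : V) :
    γ x ∈ cutPoints G o (BondConfig.relabel (sym2Equiv γ.toEquiv) ω) ↔ x ∈ cutPoints G o ω := by
  have hC : openCluster (BondConfig.relabel (sym2Equiv γ.toEquiv) ω) (γ x) =
      (γ : V → V) '' openCluster ω x := openCluster_relabel γ.toEquiv ω x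
  simp only [cutPoints, Set.mem_setOf_eq]
  rw [hC, isHeavy_image_iff G hconn γ o, levelBad_relabel_iff γ ω x, isEncounter_relabel_iff G hconn γ o ω x]

/-- `{x ∈ cutPoints}` is measurable (`V` countable). [folklore] -/
theorem measurableSet_mem_cutPoints [Countable V] (o x : V) :
    MeasurableSet {ω : BondConfig V | x ∈ cutPoints G o ω} :=
  (measurableSet_isHeavy_openCluster G o x).inter
    ((measurableSet_levelBad G x).inter (measurableSet_isEncounter G o x))

end Points

/-! ### The sample space, its law and the action of `Aut(G)` -/

section Space

variable (G : SimpleGraph V) [G.LocallyFinite] (hconn : G.Connected) (ht : IsGraphTransitive G)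
  (o : V)

/-- **The sample space of the cut route**: the percolation configuration, the parameter of the
1-partition, i.i.d. labels on `Sym2 V` (the vertex `v` is labelled by the label of `s(v, v)`),
and the seeds of the exhaustion of the levels.
[cite: Timar2006, Thm. 5.5 (proof: "the 1-partition, the percolation and some additional randomness")] -/
abbrev CutSpace : Type _ :=
  ((BondConfig V × UnitAddCircle) × (Sym2 V → ℝ)) × ExhaustionSeeds (levelGroup G o)

variable {G o} in
/-- The configuration coordinate. [folklore] -/
abbrev CutSpace.conf (ζ : CutSpace G o) : BondConfig V := ζ.1.1.1
variable {G o} in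
/-- The parameter of the 1-partition. [folklore] -/
abbrev CutSpace.par (ζ : CutSpace G o) : UnitAddCircle := ζ.1.1.2
variable {G o} in
/-- The vertex labels (diagonal of the edge labels). [folklore] -/
abbrev CutSpace.lab (ζ : CutSpace G o) (v : V) : ℝ := ζ.1.2 s(v, v)
variable {G o} in
/-- The seed of the exhaustion. [folklore] -/
abbrev CutSpace.seed (ζ : CutSpace G o) : ExhaustionSeeds (levelGroup G o) := ζ.2

/-- **The law**: Bernoulli(`p`) percolation, Haar probability on the circle, i.i.d. uniform
labels and the seed measure, all independent. [cite: Timar2006, Thm. 5.5 (proof: independent extra randomness)] -/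
def cutMeasure (p : unitInterval) : Measure (CutSpace G o) :=
  (((bondPercolation G p).prod (volume : Measure UnitAddCircle)).prod (labelMeasure V)).prod
    (boxSeedMeasure (LevelCoordIndex (levelGroup G o)))

/-- **The diagonal action of `Aut(G)`** on the sample space. [cite: Timar2006, Thm. 5.5 (proof: "equivariant")] -/
def cutAct (γ : G ≃g G) : CutSpace G o → CutSpace G o :=
  Prod.map (Prod.map (Prod.map (BondConfig.relabel (sym2Equiv γ.toEquiv)) (onePartitionAct G o γ))
    (actLabels γ)) (levelExhaustionAct G hconn ht o γ)

/-- The law is a probability measure. [folklore] -/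
instance isProbabilityMeasure_cutMeasure [Countable V] (p : unitInterval) :
    IsProbabilityMeasure (cutMeasure G o p) := by
  unfold cutMeasure; infer_instance

/-- The action is by measurable maps … [folklore] -/
theorem measurable_cutAct (γ : G ≃g G) : Measurable (cutAct G hconn ht o γ) :=
  (((BondConfig.relabel (sym2Equiv γ.toEquiv)).measurable.prodMap (measurable_onePartitionAct γ)).prodMap
    (measurable_actLabels γ)).prodMap (measurable_levelExhaustionAct G hconn ht o γ)

/-- … preserving the law. [cite: Timar2006, Thm. 5.5 (proof: invariance of the extra randomness)] -/
theorem measurePreserving_cutAct [Countable V] (p : unitInterval) (γ : G ≃g G) :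
    MeasurePreserving (cutAct G hconn ht o γ) (cutMeasure G o p) (cutMeasure G o p) := by
  unfold cutAct cutMeasure
  refine MeasurePreserving.prod (MeasurePreserving.prod (MeasurePreserving.prod ?_ ?_) ?_) ?_
  · exact ⟨(BondConfig.relabel (sym2Equiv γ.toEquiv)).measurable, bondPercolation_map_relabel_iso γ p⟩
  · exact measurePreserving_onePartitionAct γ
  · exact ⟨measurable_actLabels γ, labelMeasure_map_actLabels γ⟩
  · exact measurePreserving_levelExhaustionAct G hconn ht o γ

/-- `Measure.map` form of the invariance. [folklore] -/
theorem map_cutAct [Countable V] (p : unitInterval) (γ : G ≃g G) :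
    (cutMeasure G o p).map (cutAct G hconn ht o γ) = cutMeasure G o p :=
  (measurePreserving_cutAct G hconn ht o p γ).map_eq

/-! #### The coordinates -/

variable {G o}

/-- The coordinates are measurable. [folklore] -/
theorem measurable_conf : Measurable (CutSpace.conf : CutSpace G o → BondConfig V) :=
  measurable_fst.fst.fst

/-- The parameter is measurable. [folklore] -/
theorem measurable_par : Measurable (CutSpace.par : CutSpace G o → UnitAddCircle) :=
  measurable_fst.fst.snd

/-- Each vertex label is measurable. [folklore] -/
theorem measurable_lab (v : V) : Measurable fun ζ : CutSpace G o => ζ.lab v :=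
  (measurable_pi_apply _).comp measurable_fst.snd

/-- The seed is measurable. [folklore] -/
theorem measurable_seed : Measurable (CutSpace.seed : CutSpace G o → ExhaustionSeeds (levelGroup G o)) :=
  measurable_snd

/-- The action on the coordinates: configuration. [folklore] -/
@[simp] theorem conf_cutAct (γ : G ≃g G) (ζ : CutSpace G o) :
    (cutAct G hconn ht o γ ζ).conf = BondConfig.relabel (sym2Equiv γ.toEquiv) ζ.conf := rfl

/-- The action on the coordinates: parameter. [folklore] -/
@[simp] theorem par_cutAct (γ : G ≃g G) (ζ : CutSpace G o) :
    (cutAct G hconn ht o γ ζ).par = onePartitionAct G o γ ζ.par := rfl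

/-- The action on the coordinates: seed. [folklore] -/
@[simp] theorem seed_cutAct (γ : G ≃g G) (ζ : CutSpace G o) :
    (cutAct G hconn ht o γ ζ).seed = levelExhaustionAct G hconn ht o γ ζ.seed := rfl

/-- **The vertex labels are equivariant**: the label of `γ v` after the action is the label of
`v`. [folklore] -/
@[simp] theorem lab_cutAct (γ : G ≃g G) (ζ : CutSpace G o) (v : V) :
    (cutAct G hconn ht o γ ζ).lab (γ v) = ζ.lab v := by
  show ζ.1.2 ((sym2Equiv γ.toEquiv.symm) s(γ v, γ v)) = ζ.1.2 s(v, v)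
  have hv : γ.toEquiv.symm (γ v) = v := γ.toEquiv.symm_apply_apply v
  rw [sym2Equiv_apply, Sym2.map_mk]
  erw [hv]

end Space

/-! ### The random data of the cut route -/

section Data

variable {G : SimpleGraph V} [G.LocallyFinite] {hconn : G.Connected} {ht : IsGraphTransitive G} {o : V}

/-- The random points `D`. [cite: Timar2006, Thm. 5.5 (proof: the set W)] -/
def cutD (G : SimpleGraph V) [G.LocallyFinite] (o : V) (ζ : CutSpace G o) : Set V := cutPoints G o ζ.conf

/-- The random pointing relation `M⃗`: targets in the class of the 1-partition, ties broken by
the labels. [cite: Timar2006, Thm. 5.5 (proof: the digraph M⃗)] -/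
def cutP (G : SimpleGraph V) [G.LocallyFinite] (o : V) (ζ : CutSpace G o) (x t : V) : Prop :=
  Points (openGraph ζ.conf) (cutPoints G o ζ.conf) (OnePartitionRel G o ζ.par) ζ.lab x t

/-- The random classes at stage `i`. [cite: Timar2006, Thm. 5.5 (proof: the partitions R_i)] -/
def cutCls (G : SimpleGraph V) [G.LocallyFinite] (hconn : G.Connected) (ht : IsGraphTransitive G)
    (o : V) (i : ℕ) (ζ : CutSpace G o) (x : V) : Set V :=
  cutClass G hconn ht o ζ.par i ζ.seed ζ.conf (cutPoints G o ζ.conf) x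

/-! #### Invariance -/

/-- `D` is equivariant. [folklore] -/
theorem mem_cutD_act_iff (hconn : G.Connected) (ht : IsGraphTransitive G) (γ : G ≃g G)
    (ζ : CutSpace G o) (x : V) : γ x ∈ cutD G o (cutAct G hconn ht o γ ζ) ↔ x ∈ cutD G o ζ :=
  mem_cutPoints_relabel_iff hconn γ o ζ.conf x

/-- The points after the action are the image of the points. [folklore] -/
theorem cutPoints_act (hconn : G.Connected) (ht : IsGraphTransitive G) (γ : G ≃g G) (ζ : CutSpace G o) :
    cutPoints G o (cutAct G hconn ht o γ ζ).conf = (γ : V → V) '' cutPoints G o ζ.conf := by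
  ext y
  constructor
  · intro hy
    refine ⟨γ.symm y, ?_, γ.apply_symm_apply y⟩
    rw [← mem_cutPoints_relabel_iff hconn γ o ζ.conf, γ.apply_symm_apply]; exact hy
  · rintro ⟨x, hx, rfl⟩; exact (mem_cutPoints_relabel_iff hconn γ o ζ.conf x).2 hx

/-- `M⃗` is equivariant. [cite: Timar2006, Thm. 5.5 (proof: "an equivariant function")] -/
theorem cutP_act_iff (hconn : G.Connected) (ht : IsGraphTransitive G) (γ : G ≃g G) (ζ : CutSpace G o)
    (x t : V) : cutP G o (cutAct G hconn ht o γ ζ) (γ x) (γ t) ↔ cutP G o ζ x t := by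
  unfold cutP
  exact points_iso_iff (openGraphRelabelIso γ.toEquiv ζ.conf)
    (Wset := cutPoints G o ζ.conf) (Wset' := cutPoints G o (cutAct G hconn ht o γ ζ).conf)
    (R := OnePartitionRel G o ζ.par) (R' := OnePartitionRel G o (cutAct G hconn ht o γ ζ).par)
    (ℓ := ζ.lab) (ℓ' := (cutAct G hconn ht o γ ζ).lab)
    (fun y => mem_cutPoints_relabel_iff hconn γ o ζ.conf y)
    (fun a b => onePartitionRel_act_iff hconn γ ζ.par a b) (fun v => lab_cutAct hconn ht γ ζ v) x t

/-- The classes are equivariant. [cite: Timar2006, Thm. 5.5 (proof: "an equivariant exhaustion R_i")] -/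
theorem mem_cutCls_act_iff (hconn : G.Connected) (ht : IsGraphTransitive G) (i : ℕ) (γ : G ≃g G)
    (ζ : CutSpace G o) (x y : V) :
    γ y ∈ cutCls G hconn ht o i (cutAct G hconn ht o γ ζ) (γ x) ↔ y ∈ cutCls G hconn ht o i ζ x := by
  unfold cutCls
  rw [cutPoints_act hconn ht γ ζ]
  exact mem_cutClass_act_iff ζ.par i ζ.seed ζ.conf (cutPoints G o ζ.conf) γ x y

/-! #### Measurability -/

variable [Countable V]

/-- `{x ∈ D}` is measurable. [folklore] -/
theorem measurableSet_mem_cutD (x : V) : MeasurableSet {ζ : CutSpace G o | x ∈ cutD G o ζ} :=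
  (measurableSet_mem_cutPoints (G := G) o x).preimage measurable_conf

omit [Countable V] in
/-- The adjacency events of the random open graph are measurable. [folklore] -/
theorem measurableSet_openGraph_conf_adj (a b : V) :
    MeasurableSet {ζ : CutSpace G o | (openGraph ζ.conf).Adj a b} :=
  measurableSet_openGraph_adj_comp measurable_conf a b

/-- `{x → t}` is measurable. [folklore] -/
theorem measurableSet_cutP (x t : V) : MeasurableSet {ζ : CutSpace G o | cutP G o ζ x t} :=
  measurableSet_points (Γ := fun ζ : CutSpace G o => openGraph ζ.conf) measurableSet_openGraph_conf_adj
    (W := fun ζ => cutPoints G o ζ.conf) (R := fun ζ => OnePartitionRel G o ζ.par) (ℓ := fun ζ => ζ.lab)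
    measurableSet_mem_cutD
    (fun a b => (measurableSet_setOf_onePartitionRel a b).preimage measurable_par) measurable_lab x t

/-- `{y ∈ cls_i(x)}` is measurable. [folklore] -/
theorem measurableSet_mem_cutCls (i : ℕ) (x y : V) :
    MeasurableSet {ζ : CutSpace G o | y ∈ cutCls G hconn ht o i ζ x} :=
  measurableSet_mem_cutClass measurable_conf measurable_par measurable_seed measurableSet_mem_cutD i x y

end Data

/-! ### The class package and the forest package -/

section Packages

variable {G : SimpleGraph V} [G.LocallyFinite]

/-- **The class package** (all sure): the classes through the points partition the points, are
finite (badness) and carry the weight bound `w(x) ≤ Δ⁻¹ w(y)`. [cite: Timar2006, Thm. 5.5 (proof: the partitions R_i)] -/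
theorem cutCls_package (hconn : G.Connected) (ht : IsGraphTransitive G) (hU : ¬ IsGraphUnimodular G)
    (o : V) (ζ : CutSpace G o) (i : ℕ) (x : V) (hx : x ∈ cutD G o ζ) :
    x ∈ cutCls G hconn ht o i ζ x ∧ cutCls G hconn ht o i ζ x ⊆ cutD G o ζ ∧
      (∀ y ∈ cutCls G hconn ht o i ζ x, cutCls G hconn ht o i ζ y = cutCls G hconn ht o i ζ x) ∧
      (cutCls G hconn ht o i ζ x).Finite ∧
      ∀ y ∈ cutCls G hconn ht o i ζ x, autWeight G o x ≤ (minNbrWeight G o)⁻¹ * autWeight G o y :=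
  ⟨mem_cutClass_self hx, cutClass_subset _ _ _ _ _ _, fun _ hy => cutClass_eq_of_mem hy,
    cutClass_finite hx.2.1, fun _ hy => autWeight_le_of_mem_cutClass hU hy⟩

/-- Injective edge labels give vertex labels injective on every set. [folklore] -/
theorem injOn_lab_of_injective {o : V} {ζ : CutSpace G o} (h : Function.Injective ζ.1.2) (S : Set V) :
    Set.InjOn ζ.lab S := by
  intro a _ b _ hab
  have h2 : s(a, a) = s(b, b) := h hab
  exact (Sym2.eq_iff.1 h2).elim (fun h' => h'.1) (fun h' => h'.1)

/-- **The forest package, from Lemma 5.3 (ii)**: if the labels are injective, `ω ⊆ E(G)`, and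
every heavy branch at every point (branch of a vertex of its cluster) contains an encounter point of the class of `x` (5.3 ii at `ω, θ`), then
the pointing graph is acyclic, pointing pairs are off-diagonal, every point has `3 ≤ #targets`,
and every vertex has `#targets ≤ deg o`.
[cite: Timar2006, Thm. 5.5 (proof: the forest F, degrees ≥ 3) and Lemma 5.3] -/
theorem cutP_package (ht : IsGraphTransitive G) (o : V) (ζ : CutSpace G o)
    (hlab : Function.Injective ζ.1.2) (hE : ζ.conf ⊆ G.edgeSet)
    (h53 : ∀ x ∈ cutPoints G o ζ.conf, ∀ u ∈ openCluster ζ.conf x, IsHeavy G o (branchSet ζ.conf x u) →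
      ∃ z ∈ branchSet ζ.conf x u, IsEncounter G o ζ.conf z ∧ OnePartitionRel G o ζ.par x z) :
    (pointGraph (cutP G o ζ)).IsAcyclic ∧ (∀ a b, cutP G o ζ a b → a ≠ b) ∧
      (∀ x ∈ cutD G o ζ, 3 ≤ ({t | cutP G o ζ x t} : Set V).encard) ∧
      ∀ x, ({t | cutP G o ζ x t} : Set V).encard ≤ (G.degree o : ℕ) := by
  have hΓ : openGraph ζ.conf ≤ G := fun a b hab => G.mem_edgeSet.1 (hE ((openGraph_adj _ a b).1 hab).1)
  have hRs : ∀ {a b}, OnePartitionRel G o ζ.par a b → OnePartitionRel G o ζ.par b a :=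
    fun h => (onePartitionRel_equivalence G o ζ.par).symm h
  have hRt : ∀ {a b c}, OnePartitionRel G o ζ.par a b → OnePartitionRel G o ζ.par b c →
      OnePartitionRel G o ζ.par a c := fun h h' => (onePartitionRel_equivalence G o ζ.par).trans h h'
  have hinj : Set.InjOn ζ.lab (cutPoints G o ζ.conf) := injOn_lab_of_injective hlab _
  refine ⟨?_, ?_, ?_, ?_⟩
  · -- `pointGraph (Points …) = targetGraph …`
    have : pointGraph (cutP G o ζ) =
        targetGraph (openGraph ζ.conf) (cutPoints G o ζ.conf) (OnePartitionRel G o ζ.par) ζ.lab := by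
      ext a b; rfl
    rw [this]
    exact targetGraph_isAcyclic hRs hRt hinj
  · rintro a b ⟨-, u, htar⟩
    exact (htar.1.1.ne_right).symm
  · intro x hx
    obtain ⟨u, hu, hsep, hheavy⟩ := hx.2.2
    refine three_le_encard_setOf_points hΓ hx u hsep fun i => ?_
    obtain ⟨z, hzB, hzE, hzR⟩ := h53 x hx (u i) (hu i) (hheavy i)
    have hzC : z ∈ openCluster ζ.conf x := by
      have h1 : z ∈ openCluster ζ.conf (u i) := branchSet_subset_openCluster ζ.conf x (u i) hzB
      exact (show (openGraph ζ.conf).Reachable x (u i) from hu i).trans h1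
    refine ⟨z, hzB, hzC, ⟨?_, hx.2.1.of_mem hzC, hzE⟩, hzR⟩
    -- `C(z) = C(x)` is heavy
    have hCz : openCluster ζ.conf z = openCluster ζ.conf x :=
      Set.ext fun w => ⟨fun hw => Reachable.trans hzC hw, fun hw => Reachable.trans hzC.symm hw⟩
    rw [hCz]; exact hx.1
  · intro x
    exact (encard_setOf_points_le_degree hΓ hinj x).trans
      (by exact_mod_cast degree_le_of_isGraphTransitive ht o x)

end Packages

/-! ### Marginals of the law -/

section Marginals

variable {G : SimpleGraph V} [G.LocallyFinite] {o : V} [Countable V]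

/-- The configuration marginal: `μ̃(conf ∈ A) = P_p(A)`. [folklore] -/
theorem cutMeasure_setOf_conf_mem (p : unitInterval) (A : Set (BondConfig V)) :
    cutMeasure G o p {ζ | ζ.conf ∈ A} = bondPercolation G p A := by
  have h : {ζ : CutSpace G o | ζ.conf ∈ A} =
      ((A ×ˢ (Set.univ : Set UnitAddCircle)) ×ˢ (Set.univ : Set (Sym2 V → ℝ))) ×ˢ
        (Set.univ : Set (ExhaustionSeeds (levelGroup G o))) := by
    ext ζ; simp [CutSpace.conf]
  rw [h, cutMeasure, Measure.prod_prod, Measure.prod_prod, Measure.prod_prod]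
  simp

/-- The label marginal: `μ̃(labels ∈ B) = labelMeasure(B)`. [folklore] -/
theorem cutMeasure_setOf_labels_mem (p : unitInterval) (B : Set (Sym2 V → ℝ)) :
    cutMeasure G o p {ζ | ζ.1.2 ∈ B} = labelMeasure V B := by
  have h : {ζ : CutSpace G o | ζ.1.2 ∈ B} =
      (((Set.univ : Set (BondConfig V × UnitAddCircle))) ×ˢ B) ×ˢ
        (Set.univ : Set (ExhaustionSeeds (levelGroup G o))) := by
    ext ζ; simp
  rw [h, cutMeasure, Measure.prod_prod, Measure.prod_prod]
  simp

/-- The `(ω, θ)` marginal: `μ̃((conf, par) ∈ C) = (P_p ⊗ Haar)(C)`. [folklore] -/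
theorem cutMeasure_setOf_confPar_mem (p : unitInterval) (C : Set (BondConfig V × UnitAddCircle)) :
    cutMeasure G o p {ζ | ζ.1.1 ∈ C} = ((bondPercolation G p).prod (volume : Measure UnitAddCircle)) C := by
  have h : {ζ : CutSpace G o | ζ.1.1 ∈ C} =
      (C ×ˢ (Set.univ : Set (Sym2 V → ℝ))) ×ˢ (Set.univ : Set (ExhaustionSeeds (levelGroup G o))) := by
    ext ζ; simp
  rw [h, cutMeasure, Measure.prod_prod, Measure.prod_prod]
  simp

/-- Almost surely the configuration lies in `E(G)`. [folklore] -/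
theorem ae_conf_subset (p : unitInterval) : ∀ᵐ ζ ∂(cutMeasure G o p), ζ.conf ⊆ G.edgeSet := by
  rw [ae_iff]
  have h := cutMeasure_setOf_conf_mem (G := G) (o := o) p {ω | ¬ ω ⊆ G.edgeSet}
  simp only [Set.mem_setOf_eq] at h
  rw [h]
  exact ae_iff.1 (ProbabilityTheory.setBernoulli_ae_subset (u := G.edgeSet) (p := p))

/-- Almost surely the labels are injective. [folklore] -/
theorem ae_labels_injective (p : unitInterval) : ∀ᵐ ζ ∂(cutMeasure G o p), Function.Injective ζ.1.2 := by
  rw [ae_iff]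
  have h := cutMeasure_setOf_labels_mem (G := G) (o := o) p {U | ¬ Function.Injective U}
  simp only [Set.mem_setOf_eq] at h
  rw [h]
  exact ae_iff.1 ae_injective_labelMeasure

/-- An almost sure statement about `(ω, θ)` lifts to the sample space. [folklore] -/
theorem ae_confPar_of_ae (p : unitInterval) {P : BondConfig V × UnitAddCircle → Prop}
    (h : ∀ᵐ q ∂((bondPercolation G p).prod (volume : Measure UnitAddCircle)), P q) :
    ∀ᵐ ζ ∂(cutMeasure G o p), P ζ.1.1 := by
  rw [ae_iff]
  have h' := cutMeasure_setOf_confPar_mem (G := G) (o := o) p {q | ¬ P q}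
  simp only [Set.mem_setOf_eq] at h'
  rw [h']
  exact ae_iff.1 h

end Marginals

/-! ### The exhaustion in probability -/

section Exhaustion

variable {G : SimpleGraph V} [G.LocallyFinite]

/-- A walk of `openGraph ω ⊓ withinGraph ⊤ F` starting in `F` is an open walk inside `F`.
[folklore] -/
theorem exists_openWalk_of_reachable_within {ω : BondConfig V} {F : Set V} :
    ∀ {a b : V} (_ : (openGraph ω ⊓ withinGraph ⊤ F).Walk a b), a ∈ F →
      ∃ π : (openGraph ω).Walk a b, ∀ v ∈ π.support, v ∈ F
  | _, _, .nil, ha => ⟨Walk.nil, fun v hv => by rw [Walk.support_nil, List.mem_singleton] at hv; exact hv ▸ ha⟩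
  | a, b, .cons (v := c) hadj q, ha => by
    have hc : c ∈ F := hadj.2.2.2
    obtain ⟨π, hπ⟩ := exists_openWalk_of_reachable_within q hc
    refine ⟨Walk.cons hadj.1 π, fun v hv => ?_⟩
    rw [Walk.support_cons, List.mem_cons] at hv
    rcases hv with rfl | hv
    · exact ha
    · exact hπ v hv

/-- An open walk with support in `S` is a walk of `openGraph ω ⊓ withinGraph ⊤ S`. [folklore] -/
theorem reachable_within_of_openWalk {ω : BondConfig V} {S : Set V} :
    ∀ {a b : V} (π : (openGraph ω).Walk a b), (∀ v ∈ π.support, v ∈ S) →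
      (openGraph ω ⊓ withinGraph ⊤ S).Reachable a b
  | _, _, .nil, _ => Reachable.refl _
  | a, b, .cons (v := c) hadj q, hs => by
    rw [Walk.support_cons] at hs
    have ha : a ∈ S := hs a List.mem_cons_self
    have hc : c ∈ S := hs c (List.mem_cons_of_mem _ q.start_mem_support)
    have hstep : (openGraph ω ⊓ withinGraph ⊤ S).Adj a c := by
      rw [inf_adj, withinGraph_adj]
      exact ⟨hadj, hadj.ne, ha, hc⟩
    exact hstep.reachable.trans (reachable_within_of_openWalk q fun v hv => hs v (List.mem_cons_of_mem _ hv))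

variable [Countable V]

omit [Countable V] in
/-- **The cut event lies in the split event**: if `x → t` and `t ∉ cls_i(x)` (and `ω ⊆ E(G)`),
then `x, t` are joined by an open path and, for EVERY finite `F` through which they are joined by
an open path, some vertex of `F` is not `P_i`-related to `x` (`mem_cutClass_of_walk`).
[cite: Timar2006, Thm. 5.5 (proof: "the endpoints of any edge of Φ are in the same component of R_i" fails only when levels are split)] -/
theorem cutEvent_subset (hconn : G.Connected) (ht : IsGraphTransitive G) (o : V) (i : ℕ) (x t : V) :
    {ζ : CutSpace G o | cutP G o ζ x t ∧ t ∉ cutCls G hconn ht o i ζ x} ⊆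
      {ζ | ¬ ζ.conf ⊆ G.edgeSet} ∪
      {ζ | (openGraph ζ.conf).Reachable x t ∧ ∀ F : Finset V, x ∈ F →
        t ∈ openClusterIn (withinGraph ⊤ (↑F : Set V)) ζ.conf x →
          ∃ v ∈ F, ¬ LevelExhaustionRel G hconn ht o i ζ.seed x v} := by
  rintro ζ ⟨⟨-, u, htar⟩, hnot⟩
  by_cases hE : ζ.conf ⊆ G.edgeSet
  · right
    refine ⟨htar.1.2.1, fun F hxF htF => ?_⟩
    by_contra hall
    push Not at hall
    obtain ⟨q⟩ := (mem_openClusterIn_iff.1 htF)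
    obtain ⟨π, hπ⟩ := exists_openWalk_of_reachable_within q (Finset.mem_coe.2 hxF)
    exact hnot (mem_cutClass_of_walk hE htar.1.2.2.1 htar.1.2.2.2 π
      fun v hv => hall v (Finset.mem_coe.1 (hπ v hv)))
  · exact Or.inl hE

/-- The split event is measurable. [folklore] -/
theorem measurableSet_splitEvent (hconn : G.Connected) (ht : IsGraphTransitive G) (o : V) (i : ℕ)
    (x t : V) :
    MeasurableSet {ζ : CutSpace G o | (openGraph ζ.conf).Reachable x t ∧ ∀ F : Finset V, x ∈ F →
      t ∈ openClusterIn (withinGraph ⊤ (↑F : Set V)) ζ.conf x →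
        ∃ v ∈ F, ¬ LevelExhaustionRel G hconn ht o i ζ.seed x v} := by
  have h : {ζ : CutSpace G o | (openGraph ζ.conf).Reachable x t ∧ ∀ F : Finset V, x ∈ F →
      t ∈ openClusterIn (withinGraph ⊤ (↑F : Set V)) ζ.conf x →
        ∃ v ∈ F, ¬ LevelExhaustionRel G hconn ht o i ζ.seed x v} =
      {ζ | (openGraph ζ.conf).Reachable x t} ∩ ⋂ F : Finset V,
        ({ζ | x ∈ F ∧ ζ.conf ∈ openConnVia (withinGraph ⊤ (↑F : Set V)) x t}ᶜ ∪
          ⋃ v ∈ F, {ζ | ¬ LevelExhaustionRel G hconn ht o i ζ.seed x v}) := by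
    ext ζ
    simp only [Set.mem_setOf_eq, Set.mem_inter_iff, Set.mem_iInter, Set.mem_union, Set.mem_compl_iff,
      Set.mem_iUnion, openConnVia, not_and, exists_prop]
    refine and_congr_right fun _ => forall_congr' fun F => ?_
    constructor
    · intro h'
      by_cases hxF : x ∈ F
      · by_cases htF : t ∈ openClusterIn (withinGraph ⊤ (↑F : Set V)) ζ.conf x
        · exact Or.inr (h' hxF htF)
        · exact Or.inl fun _ => htF
      · exact Or.inl fun h => absurd h hxF
    · rintro (h' | h') hxF htF
      · exact absurd htF (h' hxF)
      · exact h'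
  rw [h]
  refine (measurableSet_reachable_comp measurable_conf x t).inter (MeasurableSet.iInter fun F => ?_)
  refine (((MeasurableSet.const _).inter ((measurableSet_openConnVia _ x t).preimage measurable_conf)).compl).union ?_
  exact Finset.measurableSet_biUnion F fun v _ =>
    ((measurableSet_setOf_levelExhaustionRel G hconn ht o i x v).preimage measurable_seed).compl

/-- **The split event has probability tending to zero** (Fubini over the seeds: above a fixed
`(ω, θ, U)` with `x ↔ t`, the section is contained in "the levels of the vertices of a fixed open
path from `x` to `t` are not inside one class of `P_i`", `tendsto_measure_not_forall_levelExhaustionRel`;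
dominated convergence). [cite: Timar2006, Thm. 5.5 (proof: "with probability tending to 1") and Prop. 5.4] -/
theorem tendsto_cutMeasure_splitEvent (hconn : G.Connected) (ht : IsGraphTransitive G) (o : V)
    (p : unitInterval) (x t : V) :
    Tendsto (fun i => cutMeasure G o p {ζ : CutSpace G o | (openGraph ζ.conf).Reachable x t ∧
      ∀ F : Finset V, x ∈ F → t ∈ openClusterIn (withinGraph ⊤ (↑F : Set V)) ζ.conf x →
        ∃ v ∈ F, ¬ LevelExhaustionRel G hconn ht o i ζ.seed x v}) atTop (𝓝 0) := by
  classical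
  set μ₁ := ((bondPercolation G p).prod (volume : Measure UnitAddCircle)).prod (labelMeasure V) with hμ₁
  set ν := boxSeedMeasure (LevelCoordIndex (levelGroup G o)) with hν
  set S : ℕ → Set (CutSpace G o) := fun i => {ζ | (openGraph ζ.conf).Reachable x t ∧
      ∀ F : Finset V, x ∈ F → t ∈ openClusterIn (withinGraph ⊤ (↑F : Set V)) ζ.conf x →
        ∃ v ∈ F, ¬ LevelExhaustionRel G hconn ht o i ζ.seed x v} with hS
  have hSm : ∀ i, MeasurableSet (S i) := fun i => measurableSet_splitEvent hconn ht o i x t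
  change Tendsto (fun i => cutMeasure G o p (S i)) atTop (𝓝 0)
  -- Fubini
  have happ : ∀ i, cutMeasure G o p (S i) = ∫⁻ ζ₁, ν (Prod.mk ζ₁ ⁻¹' S i) ∂μ₁ := fun i => by
    rw [cutMeasure, Measure.prod_apply (hSm i)]
  simp_rw [happ]
  -- pointwise: the section is small
  have hpt : ∀ ζ₁, Tendsto (fun i => ν (Prod.mk ζ₁ ⁻¹' S i)) atTop (𝓝 0) := by
    intro ζ₁
    by_cases hr : (openGraph ζ₁.1.1).Reachable x t
    · obtain ⟨π⟩ := hr
      set F₀ : Finset V := π.support.toFinset with hF₀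
      have hxF₀ : x ∈ F₀ := by rw [hF₀, List.mem_toFinset]; exact π.start_mem_support
      have hsub : ∀ i, Prod.mk ζ₁ ⁻¹' S i ⊆
          {ξ | ¬ ∀ a ∈ F₀, ∀ b ∈ F₀, LevelExhaustionRel G hconn ht o i ξ a b} := by
        intro i ξ hξ hall
        obtain ⟨-, hF⟩ := hξ
        have htF : t ∈ openClusterIn (withinGraph ⊤ (↑F₀ : Set V)) ζ₁.1.1 x :=
          mem_openClusterIn_iff.2 (reachable_within_of_openWalk π fun v hv => by
            rw [Finset.mem_coe, hF₀, List.mem_toFinset]; exact hv)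
        obtain ⟨v, hv, hnot⟩ := hF F₀ hxF₀ htF
        exact hnot (hall x hxF₀ v hv)
      exact tendsto_of_tendsto_of_tendsto_of_le_of_le tendsto_const_nhds
        (tendsto_measure_not_forall_levelExhaustionRel G hconn ht o F₀)
        (fun i => bot_le) (fun i => measure_mono (hsub i))
    · have h0 : ∀ i, Prod.mk ζ₁ ⁻¹' S i = ∅ := fun i =>
        Set.eq_empty_of_forall_notMem fun ξ hξ => hr hξ.1
      have hf : (fun i => ν (Prod.mk ζ₁ ⁻¹' S i)) = fun _ => 0 := funext fun i => by
        rw [h0 i, measure_empty]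
      rw [hf]
      exact tendsto_const_nhds
  have hmeas : ∀ i, Measurable fun ζ₁ => ν (Prod.mk ζ₁ ⁻¹' S i) := fun i =>
    measurable_measure_prodMk_left (hSm i)
  have h := tendsto_lintegral_of_dominated_convergence (μ := μ₁) (fun _ => ν Set.univ) hmeas
    (fun i => Eventually.of_forall fun ζ₁ => measure_mono (Set.subset_univ _))
    (by rw [lintegral_const]; exact ENNReal.mul_ne_top (measure_ne_top _ _) (measure_ne_top _ _))
    (Eventually.of_forall hpt)
  simpa only [lintegral_zero] using h

/-- **The exhaustion in probability**: `μ̃(x → t, t ∉ cls_i(x)) → 0`.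
[cite: Timar2006, Thm. 5.5 (proof: "the sequence (R_i) exhausts Φ")] -/
theorem tendsto_cutMeasure_cutEvent (hconn : G.Connected) (ht : IsGraphTransitive G) (o : V)
    (p : unitInterval) (x t : V) :
    Tendsto (fun i => cutMeasure G o p {ζ : CutSpace G o | cutP G o ζ x t ∧
      t ∉ cutCls G hconn ht o i ζ x}) atTop (𝓝 0) := by
  have hN : cutMeasure G o p {ζ : CutSpace G o | ¬ ζ.conf ⊆ G.edgeSet} = 0 := ae_iff.1 (ae_conf_subset p)
  refine tendsto_of_tendsto_of_tendsto_of_le_of_le tendsto_const_nhds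
    (tendsto_cutMeasure_splitEvent hconn ht o p x t) (fun i => bot_le) fun i => ?_
  calc cutMeasure G o p {ζ : CutSpace G o | cutP G o ζ x t ∧ t ∉ cutCls G hconn ht o i ζ x}
      ≤ cutMeasure G o p ({ζ | ¬ ζ.conf ⊆ G.edgeSet} ∪ {ζ | (openGraph ζ.conf).Reachable x t ∧
          ∀ F : Finset V, x ∈ F → t ∈ openClusterIn (withinGraph ⊤ (↑F : Set V)) ζ.conf x →
            ∃ v ∈ F, ¬ LevelExhaustionRel G hconn ht o i ζ.seed x v}) :=
        measure_mono (cutEvent_subset hconn ht o i x t)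
    _ ≤ cutMeasure G o p {ζ | ¬ ζ.conf ⊆ G.edgeSet} + _ := measure_union_le _ _
    _ = _ := by rw [hN, zero_add]

end Exhaustion

/-! ### The conclusion -/

section Conclusion

variable {G : SimpleGraph V} [G.LocallyFinite] [Countable V]

/-- **The forest of the cut route is almost surely empty**: given Lemma 5.3 (ii) on `(ω, θ)`,
`μ̃(x ∈ D) = 0` for every vertex `x` (`measure_mem_eq_zero_of_cut_exhaustion` with the class
package, the forest package and the exhaustion in probability).
[cite: Timar2006, Thm. 5.5 (proof) and Lemma 5.3] -/
theorem cutMeasure_mem_cutD_eq_zero (hconn : G.Connected) (ht : IsGraphTransitive G)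
    (hU : ¬ IsGraphUnimodular G) (o : V) (p : unitInterval)
    (h53 : ∀ᵐ q ∂((bondPercolation G p).prod (volume : Measure UnitAddCircle)),
      ∀ x ∈ cutPoints G o q.1, ∀ u ∈ openCluster q.1 x, IsHeavy G o (branchSet q.1 x u) →
        ∃ z ∈ branchSet q.1 x u, IsEncounter G o q.1 z ∧ OnePartitionRel G o q.2 x z) (x : V) :
    cutMeasure G o p {ζ | x ∈ cutD G o ζ} = 0 := by
  have hΔ0 := minNbrWeight_ne_zero hconn o
  refine measure_mem_eq_zero_of_cut_exhaustion hconn ht (cutMeasure G o p) (cutAct G hconn ht o)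
    (measurable_cutAct G hconn ht o) (map_cutAct G hconn ht o p) (D := cutD G o) (P := cutP G o)
    (cls := cutCls G hconn ht o) measurableSet_mem_cutD measurableSet_cutP
    (fun i x y => measurableSet_mem_cutCls i x y) (fun γ ζ x => mem_cutD_act_iff hconn ht γ ζ x)
    (fun γ ζ x t => cutP_act_iff hconn ht γ ζ x t) (fun i γ ζ x y => mem_cutCls_act_iff hconn ht i γ ζ x y)
    o (B := (minNbrWeight G o)⁻¹) (ENNReal.inv_ne_top.2 hΔ0) (G.degree o)
    (ae_of_all _ fun ζ i x hx => cutCls_package hconn ht hU o ζ i x hx) ?_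
    (fun x t => tendsto_cutMeasure_cutEvent hconn ht o p x t) x
  filter_upwards [ae_labels_injective p, ae_conf_subset p, ae_confPar_of_ae (o := o) p h53]
    with ζ hlab hE h53ζ
  exact cutP_package ht o ζ hlab hE h53ζ

/-- **Hence almost surely no vertex is an encounter point of a bad heavy cluster** (given
Lemma 5.3 (ii)). [cite: Timar2006, Thm. 5.5 (proof) and Lemma 5.3] -/
theorem ae_not_mem_cutPoints (hconn : G.Connected) (ht : IsGraphTransitive G)
    (hU : ¬ IsGraphUnimodular G) (o : V) (p : unitInterval)
    (h53 : ∀ᵐ q ∂((bondPercolation G p).prod (volume : Measure UnitAddCircle)),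
      ∀ x ∈ cutPoints G o q.1, ∀ u ∈ openCluster q.1 x, IsHeavy G o (branchSet q.1 x u) →
        ∃ z ∈ branchSet q.1 x u, IsEncounter G o q.1 z ∧ OnePartitionRel G o q.2 x z) :
    ∀ᵐ ω ∂(bondPercolation G p), ∀ x, x ∉ cutPoints G o ω := by
  rw [ae_all_iff]
  intro x
  rw [ae_iff]
  have h := cutMeasure_setOf_conf_mem (G := G) (o := o) p {ω | x ∈ cutPoints G o ω}
  simp only [not_not]
  simp only [Set.mem_setOf_eq] at h
  rw [← h]
  exact cutMeasure_mem_cutD_eq_zero hconn ht hU o p h53 x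

/-- **Thm. 5.5 modulo Lemma 5.3, core**: on an infinite countable, connected, locally finite,
transitive, nonunimodular graph and for any `p`, "almost surely infinitely many bad heavy
clusters" contradicts Lemma 5.3 (i) + (ii). [cite: Timar2006, Thm. 5.5 (proof) and Lemma 5.3] -/
theorem false_of_ae_infinite_bad_of_lemma53 (hconn : G.Connected) (ht : IsGraphTransitive G)
    (hU : ¬ IsGraphUnimodular G) (o : V) (p : unitInterval)
    (hbad : ∀ᵐ ω ∂(bondPercolation G p), (badHeavyClusters G o ω).Infinite)
    (h53i : (∀ᵐ ω ∂(bondPercolation G p), (badHeavyClusters G o ω).Infinite) →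
      ¬ ∀ᵐ ω ∂(bondPercolation G p), ∀ x, x ∉ cutPoints G o ω)
    (h53ii : ∀ᵐ q ∂((bondPercolation G p).prod (volume : Measure UnitAddCircle)),
      ∀ x ∈ cutPoints G o q.1, ∀ u ∈ openCluster q.1 x, IsHeavy G o (branchSet q.1 x u) →
        ∃ z ∈ branchSet q.1 x u, IsEncounter G o q.1 z ∧ OnePartitionRel G o q.2 x z) : False :=
  h53i hbad (ae_not_mem_cutPoints hconn ht hU o p h53ii)

end Conclusion

/-- **Timár 2006, Thm. 5.5 from Lemma 5.3, PROVED (cut route).** The vendored fact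
`Timar2006_finiteLevelUnion` follows from the two statements of Lemma 5.3 — (i) with almost
surely infinitely many bad heavy clusters (`0 < p < 1`, almost surely infinitely many heavy
clusters), with positive probability some vertex is an encounter point of a bad heavy cluster;
(ii) almost surely in `(ω, θ)`, every heavy branch at an encounter point `x` of a bad heavy cluster
contains an encounter point of the class of `x` in the 1-partition — through
`Timar2006_finiteLevelUnion_of_not_ae_infinite_bad` (`TimarBadClusters.lean`) and
`false_of_ae_infinite_bad_of_lemma53`. [cite: Timar2006, Thm. 5.5 and Lemma 5.3] -/
theorem Timar2006_finiteLevelUnion_of_lemma53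
    (h53i : ∀ {V : Type} [Infinite V] [Countable V] (G : SimpleGraph V) [G.LocallyFinite],
      G.Connected → IsGraphTransitive G → ¬ IsGraphUnimodular G → ∀ (o : V) (p : unitInterval),
        0 < (p : ℝ) → (p : ℝ) < 1 →
        (∀ᵐ ω ∂(bondPercolation G p), (heavyClusters G o ω).Infinite) →
        (∀ᵐ ω ∂(bondPercolation G p), (badHeavyClusters G o ω).Infinite) →
          ¬ ∀ᵐ ω ∂(bondPercolation G p), ∀ x, x ∉ cutPoints G o ω)
    (h53ii : ∀ {V : Type} [Infinite V] [Countable V] (G : SimpleGraph V) [G.LocallyFinite],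
      G.Connected → IsGraphTransitive G → ¬ IsGraphUnimodular G → ∀ (o : V) (p : unitInterval),
        0 < (p : ℝ) → (p : ℝ) < 1 →
        (∀ᵐ ω ∂(bondPercolation G p), (heavyClusters G o ω).Infinite) →
          ∀ᵐ q ∂((bondPercolation G p).prod (volume : Measure UnitAddCircle)),
            ∀ x ∈ cutPoints G o q.1, ∀ u ∈ openCluster q.1 x, IsHeavy G o (branchSet q.1 x u) →
              ∃ z ∈ branchSet q.1 x u, IsEncounter G o q.1 z ∧ OnePartitionRel G o q.2 x z) :
    Timar2006_finiteLevelUnion :=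
  Timar2006_finiteLevelUnion_of_not_ae_infinite_bad fun G _ hconn ht hU o p hp0 hp1 hheavy hbad =>
    false_of_ae_infinite_bad_of_lemma53 hconn ht hU o p hbad
      (h53i G hconn ht hU o p hp0 hp1 hheavy) (h53ii G hconn ht hU o p hp0 hp1 hheavy)

/-- **Timár 2006, Thm. 5.5, PROVED** (`Timar2006_finiteLevelUnion_holds`): "Consider Bernoulli
percolation on some nonunimodular transitive graph `G` and suppose that it has infinitely many
heavy components. Then with probability 1, for any infinite [heavy] component `C`, there is some
finite union `L` of levels such that `L ∩ C` has some infinite connected component" — the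
vendored named fact `Timar2006_finiteLevelUnion` (`TimarCriticalNonunimodular.lean`), discharged
by the cut route: `Timar2006_finiteLevelUnion_of_lemma53` with Lemma 5.3 (i)
(`not_ae_forall_not_badEncounter`) and Lemma 5.3 (ii) (`ae_exists_isEncounter_of_branch`).
[cite: Timar2006, Thm. 5.5] -/
theorem Timar2006_finiteLevelUnion_holds : Timar2006_finiteLevelUnion :=
  Timar2006_finiteLevelUnion_of_lemma53
    (fun G _ hconn _ _ o p hp0 hp1 _ hbad => not_ae_forall_not_badEncounter hconn o hp0 hp1 hbad)
    (fun G _ hconn ht hU o p hp0 hp1 _ => by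
      filter_upwards [ae_exists_isEncounter_of_branch hconn ht hU hp0 hp1 o] with q hq x hx u hu hH
      exact hq x hx.2.2 u hu hH)

end Literature.Barriers.CriticalPhenomena

end
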